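import Summits.ResolutionOfSingularities.ResolutionOfSingularities.Theorems.EquisingularLiftEquisingularLiftNatEmbeddedCurveLiftOfFactClosed
import Summits.ResolutionOfSingularities.ResolutionOfSingularities.Theorems.EquisingularLiftEquisingularLiftNatFlatOfLevels
import Summits.ResolutionOfSingularities.ResolutionOfSingularities.Theorems.EquisingularLiftEquisingularLiftNatEmbeddedInfinitesimalLiftFactDefs
import Literature.AlgebraicGeometry.FormalGeometry.GrothendieckExistence
import Literature.AlgebraicGeometry.Morphisms.FormalFunctions
import Mathlib.AlgebraicGeometry.Morphisms.Flat
import Mathlib.AlgebraicGeometry.Morphisms.Proper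
import Mathlib.RingTheory.DiscreteValuationRing.Basic
import HarnessLib

/-!
# [OURS · L1 W4.5(b) · EL♮(3) · (T-k)] THE (F)-ASSEMBLY: `EmbeddedInfinitesimalLiftFact → GrothendieckExistence → EmbeddedLiftFact`
# (Hartshorne 2010, Thm. 22.3 with a general proper flat ambient, ASSEMBLED from its one infinitesimal step J1, Grothendieck's existence theorem
# F-88 and the flatness joint J3), hence `… → EmbeddedCurveLiftFact` = the registered NEED-FACT stub `stub_elnat_embeddedCurveLiftFact`

Crux chain w45b (cell `res-hironaka`, slot W4.5(b)), working crux **EL♮** = stmt-ResolutionOfSingularities-20038, child **EL♮(3)** =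
stmt-ResolutionOfSingularities-20148, route EquisingularLift, line `sections`; skeletons NINETEENTH → TWENTY-FIRST (res-L1-w45b-lead-2 g4) register
`stub_elnat_embeddedCurveLiftFact : EmbeddedCurveLiftFact` (…NatTowerRoundFourDefs, p594791) as the NEED-FACT behind the genus-free rounds of
DEF-TOWER₆ / DEF-NOSE-TOWER₇. Written by res-type-027 g16 (desk deals 2026-08-28T01:43:51Z / 01:57:35Z / 02:11Z); (T-k) census
`Cruxes/EquisingularLiftNatThree/Lines/TK-CENSUS-res-type-027.md`. HONEST FRAMING: OURS; NOT a statement of H. Hironaka's 2017 manuscript;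
AI-written, gate-checked, weaker than expert review. No `sorry`; standard axioms; DEF-FREE. `--supports stmt-ResolutionOfSingularities-20148 --as helper`.

RESULT. `embeddedLiftFact_of_infinitesimal_of_grothendieckExistence : EmbeddedInfinitesimalLiftFact → FormalGeometry.GrothendieckExistence → EmbeddedLiftFact`
and `embeddedCurveLiftFact_of_infinitesimal_of_grothendieckExistence : … → EmbeddedCurveLiftFact`. So the registered stub (T-k) holds MODULO EXACTLY TWO
PUBLISHED FACTS, both typed in the tree as hypotheses with page locators: J1 = `EmbeddedInfinitesimalLiftFact` (…NatEmbeddedInfinitesimalLiftFactDefs,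
p596985: R. Hartshorne, *Deformation Theory* (2010), Thm. 6.2 (b) + Rem. 6.2.1 + Thm. 9.2 (b), pp. 54/87, instance `O/𝔪ⁿ⁺² ↠ O/𝔪ⁿ⁺¹`) and F-88 =
`Literature.AlgebraicGeometry.FormalGeometry.GrothendieckExistence` (Görtz–Wedhorn II Prop. 24.109 / EGA III₁ 5.1.4–5.1.8). Everything else —
the recursion, the algebraisation bookkeeping, the flatness of the limit (J3: res-L1-w45b-lead-2's `flat_of_forall_flat_quotient_pow` p596343, globalised
in …NatFlatOfLevels p597760), the special fibre, and the tower plumbing P0–P5 (…NatEmbeddedCurveLiftOfFact p596306 / …Closed p597023 with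
res-D-pv-035's P2 p596496) — is kernel-checked.

PROOF of the assembly (= Hartshorne's proof of Thm. 22.3, p. 169 L11: «one can lift `X₀` stepwise to a sequence of closed subschemes `X_n` …, flat over
`R_n`. The limit of these is a … formal subscheme …, which is effective»). Let `𝔪 = ker θ` (`θ` onto the field `k` from the local `O`), `W_n = W ×_O O/𝔪ⁿ⁺¹`
(tree `Morphisms.infinitesimalNeighbourhood 𝔪 w n`, maps `ι n`, `toSpec n`, `transition n`), and `e n : W₀ ⟶ W_n` the special fibre inside `W_n`
(`hsq.isoPullback ≫ toInfinitesimalNeighbourhood`; `e n ≫ ι n = jW`, `e n ≫ transition n = e (n+1)`). STAGE `n` = a closed `jₙ : Yₙ ↪ W_n`, flat over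
`O/𝔪ⁿ⁺¹`, with `s₀ : Y₀ ⟶ Yₙ` and a cartesian square `Y₀ = Yₙ ×_{W_n} W₀` over `e n`. Stage `0` = `Y₀` itself (`j₀ = ι ≫ e 0`; flat over the Artin
level `Spec O/𝔪¹ ≅ Spec k` — `fibreRingHom 𝔪 θ 0` is bijective —; the square is `isPullback_id_of_mono`). STEP `n → n+1` = J1 applied to stage `n`
(its restriction clause over `jW` follows from the stage's square by pasting with `isPullback_id_of_mono jₙ (ι n)`); the new stage's square is the
paste of the old one with J1's cartesian square over `transition n`. The tower `(Yₙ, jₙ, sₙ)` (`Nat.rec` + choice) is a closed formal subscheme of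
`W_{/𝔪}` ⇒ F-88 gives a closed `i : T' ↪ W` with cartesian `Yₙ = T' ×_W W_n`; `C := i.ker`. SPECIAL FIBRE: at level `0`, `Y₀ = T' ×_W W₀` along
`jW = e 0 ≫ ι 0` ⇒ `C.comap jW = ι.ker` (Mathlib `ker_fst_of_isClosedImmersion`). FLATNESS: `Yₙ = T' ×_O O/𝔪ⁿ⁺¹` is flat over `O/𝔪ⁿ⁺¹` for every `n`,
so `T' → Spec O` is flat by J3 in scheme form (`flat_of_forall_flat_levels`, …NatFlatOfLevels), and `V(C) ≅ T'` (`Hom.toImage`).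

References (method / index only): R. Hartshorne, *Deformation Theory* (2010), Thm. 22.3 (proof), Thm. 6.2, Thm. 9.2, (21.1), Thm. 21.2; A. Grothendieck,
EGA III₁ (1961), Thm. 5.1.4, Cor. 5.1.8, 0_III Prop. 10.2.6; U. Görtz, T. Wedhorn, *Algebraic Geometry II* (2023), Prop. 24.109.
-/

set_option linter.dupNamespace false

noncomputable section

open CategoryTheory CategoryTheory.Limits AlgebraicGeometry TopologicalSpace
open Literature.AlgebraicGeometry.Morphisms
open Literature.AlgebraicGeometry.Morphisms.infinitesimalNeighbourhood (toSpec transition transition_ι base)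
open Literature.AlgebraicGeometry.HodgeTheory (normalSheaf)
open Literature.AlgebraicGeometry.FormalGeometry (GrothendieckExistence)
open AlgebraicGeometry.Scheme.IdealSheafData

namespace Summit.ResolutionOfSingularities.ResolutionOfSingularities.Cruxes.EquisingularLiftNat.Sections

/-! ## Small category-theory helpers -/

/-- For a monomorphism `m`, the square `(𝟙, f; f ≫ m, m)` is cartesian. [folklore] -/
theorem isPullback_id_of_mono {C : Type*} [Category C] {P Y Z : C} (f : P ⟶ Y) (m : Y ⟶ Z) [Mono m] :
    IsPullback (𝟙 P) f (f ≫ m) m := by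
  have h1 : IsPullback (𝟙 P) f f (𝟙 Y) := IsPullback.of_horiz_isIso ⟨by simp⟩
  have h2 : IsPullback (𝟙 Y) (𝟙 Y) m m := IsKernelPair.id_of_mono m
  simpa using h1.paste_vert h2

/-! ## The assembly -/

/-- **THE (F)-ASSEMBLY: `EmbeddedInfinitesimalLiftFact → GrothendieckExistence → EmbeddedLiftFact`** (Hartshorne 2010 Thm. 22.3 with a general proper
flat ambient, from its infinitesimal step J1, Grothendieck existence F-88, and the flatness joint J3; see the module docstring for the proof).
[cite: Hartshorne2010, Thm. 22.3 (proof: stepwise lifting + Grothendieck existence)] [OURS · L1 W4.5b · (T-k) assembly] toward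
`stub_elnat_embeddedCurveLiftFact` (stmt-ResolutionOfSingularities-20148); NOT a statement of the manuscript. -/
theorem embeddedLiftFact_of_infinitesimal_of_grothendieckExistence
    (hJ1 : EmbeddedInfinitesimalLiftFact) (hGE : GrothendieckExistence.{0}) : EmbeddedLiftFact := by
  intro O _ _ _ _ k _ θ hθ W w W₀ jW tW hsq hprop hflat Y₀ ιY hι hlci hH1
  haveI := hprop; haveI := hflat; haveI := hι
  -- `θ` kills the maximal ideal (θ : O ↠ k onto a field, `O` local)
  have hIθ : (IsLocalRing.maximalIdeal O) ≤ RingHom.ker θ :=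
    (IsLocalRing.eq_maximalIdeal (RingHom.ker_isMaximal_of_surjective θ hθ)).ge
  haveI : Fact (Function.Surjective θ) := ⟨hθ⟩
  -- the special fibre inside the infinitesimal neighbourhoods: `e n : W₀ ⟶ W_n`, closed immersions with `e n ≫ ι n = jW`
  let e : ∀ n : ℕ, W₀ ⟶ infinitesimalNeighbourhood (IsLocalRing.maximalIdeal O) w n := fun n =>
    hsq.isoPullback.hom ≫ toInfinitesimalNeighbourhood (IsLocalRing.maximalIdeal O) w θ hIθ n
  have he_ι : ∀ n, e n ≫ infinitesimalNeighbourhood.ι (IsLocalRing.maximalIdeal O) w n = jW := by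
    intro n; simp only [e, Category.assoc, toInfinitesimalNeighbourhood_ι, IsPullback.isoPullback_hom_fst]
  have he_tr : ∀ n, e n ≫ transition (IsLocalRing.maximalIdeal O) w n = e (n + 1) := by
    intro n; simp only [e, Category.assoc, toInfinitesimalNeighbourhood_transition]
  haveI : ∀ n, IsClosedImmersion (e n) := fun n => by
    simp only [e]; infer_instance
  -- the stages of the recursion
  let Stage : ℕ → Type 1 := fun n =>
    Σ' (Y : Scheme.{0}) (j : Y ⟶ infinitesimalNeighbourhood (IsLocalRing.maximalIdeal O) w n) (s₀ : Y₀ ⟶ Y),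
      IsClosedImmersion j ∧ Flat (j ≫ toSpec (IsLocalRing.maximalIdeal O) w n) ∧ IsPullback s₀ ιY j (e n)
  -- level 0: `Y₀` itself
  have h0flat : Flat ((ιY ≫ e 0) ≫ toSpec (IsLocalRing.maximalIdeal O) w 0) := by
    have heq : (ιY ≫ e 0) ≫ toSpec (IsLocalRing.maximalIdeal O) w 0 =
        (ιY ≫ tW) ≫ Spec.map (CommRingCat.ofHom (fibreRingHom (IsLocalRing.maximalIdeal O) θ hIθ 0)) := by
      simp only [e, Category.assoc, toInfinitesimalNeighbourhood_toSpec, IsPullback.isoPullback_hom_snd_assoc]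
    rw [heq]
    have hbij : Function.Bijective (fibreRingHom (IsLocalRing.maximalIdeal O) θ hIθ 0) := by
      refine ⟨RingHom.lift_injective_of_ker_le_ideal _ (fun a ha => hIθ (Ideal.pow_le_self (Nat.succ_ne_zero 0) ha)) ?_,
        fun b => ?_⟩
      · rw [pow_one]; exact (IsLocalRing.eq_maximalIdeal (RingHom.ker_isMaximal_of_surjective θ hθ)).le
      · obtain ⟨a, rfl⟩ := hθ b
        exact ⟨Ideal.Quotient.mk _ a, rfl⟩
    haveI : IsIso (CommRingCat.ofHom (fibreRingHom (IsLocalRing.maximalIdeal O) θ hIθ 0)) :=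
      (RingEquiv.ofBijective _ hbij).toCommRingCatIso.isIso_hom
    infer_instance
  have h0sq : IsPullback (𝟙 Y₀) ιY (ιY ≫ e 0) (e 0) := isPullback_id_of_mono ιY (e 0)
  let S0 : Stage 0 := ⟨Y₀, ιY ≫ e 0, 𝟙 Y₀, inferInstance, h0flat, h0sq⟩
  -- the step
  have step : ∀ n (S : Stage n), ∃ (S' : Stage (n + 1)) (s : S.1 ⟶ S'.1), IsPullback s S.2.1 S'.2.1 (transition (IsLocalRing.maximalIdeal O) w n) := by
    intro n S
    obtain ⟨Y, j, s₀, hj, hjflat, hsqY⟩ := S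
    haveI := hj
    have hres : ∃ s₀' : Y₀ ⟶ Y, IsPullback s₀' ιY (j ≫ infinitesimalNeighbourhood.ι (IsLocalRing.maximalIdeal O) w n) jW := by
      refine ⟨s₀, ?_⟩
      have h2 : IsPullback (𝟙 Y) j (j ≫ infinitesimalNeighbourhood.ι (IsLocalRing.maximalIdeal O) w n) (infinitesimalNeighbourhood.ι (IsLocalRing.maximalIdeal O) w n) :=
        isPullback_id_of_mono j (infinitesimalNeighbourhood.ι (IsLocalRing.maximalIdeal O) w n)
      simpa [he_ι] using hsqY.paste_horiz h2
    obtain ⟨Y', j', s, hj', hj'flat, hsq'⟩ := hJ1 O k θ hθ W w W₀ jW tW hsq hflat inferInstance Y₀ ιY hι hlci hH1 n Y j hj hjflat hres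
    refine ⟨⟨Y', j', s₀ ≫ s, hj', hj'flat, ?_⟩, s, hsq'⟩
    simpa [he_tr] using hsqY.paste_horiz hsq'
  choose nextStage nextMap hnext using step
  let stage : ∀ n : ℕ, Stage n := fun n => Nat.rec S0 (fun n S => nextStage n S) n
  have stage_succ : ∀ n, stage (n + 1) = nextStage n (stage n) := fun n => rfl
  -- the tower handed to Grothendieck existence
  let T : ℕ → Scheme.{0} := fun n => (stage n).1
  let j : ∀ n, T n ⟶ infinitesimalNeighbourhood (IsLocalRing.maximalIdeal O) w n := fun n => (stage n).2.1
  have hjc : ∀ n, IsClosedImmersion (j n) := fun n => (stage n).2.2.2.1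
  let s : ∀ n, T n ⟶ T (n + 1) := fun n => nextMap n (stage n)
  have hs : ∀ n, IsPullback (s n) (j n) (j (n + 1)) (transition (IsLocalRing.maximalIdeal O) w n) := fun n => hnext n (stage n)
  obtain ⟨T', i, hi, r, hr⟩ := hGE (IsLocalRing.maximalIdeal O) w T j s hjc hs
  haveI := hi
  refine ⟨i.ker, ?_, ?_⟩
  · -- flatness of `V(i.ker) ≅ T'` over `O`: every level `T_n → Spec O/𝔪ⁿ⁺¹` is flat (J3, scheme form)
    haveI : IsLocallyNoetherian W := LocallyOfFiniteType.isLocallyNoetherian w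
    haveI : IsLocallyNoetherian T' := LocallyOfFiniteType.isLocallyNoetherian i
    have hlev : ∀ n, Flat (pullback.snd (i ≫ w) (base (IsLocalRing.maximalIdeal O) n)) := by
      intro n
      have hTn : IsPullback (r n) (j n ≫ toSpec (IsLocalRing.maximalIdeal O) w n) (i ≫ w) (base (IsLocalRing.maximalIdeal O) n) :=
        (hr n).paste_vert (IsPullback.of_hasPullback w (base (IsLocalRing.maximalIdeal O) n))
      haveI : Flat (j n ≫ toSpec (IsLocalRing.maximalIdeal O) w n) := (stage n).2.2.2.2.1
      rw [← hTn.isoPullback_inv_snd]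
      infer_instance
    haveI hflat' : Flat (i ≫ w) := flat_of_forall_flat_levels (i ≫ w) hlev
    have h1 : Flat (i.toImage ≫ i.ker.subschemeι ≫ w) := by
      rw [← Category.assoc]
      change Flat ((i.toImage ≫ i.imageι) ≫ w)
      rw [i.toImage_imageι]; exact hflat'
    exact (MorphismProperty.cancel_left_of_respectsIso @Flat i.toImage _).mp h1
  · -- special fibre: level 0
    have hr0 : IsPullback (r 0) (ιY ≫ e 0) i (infinitesimalNeighbourhood.ι (IsLocalRing.maximalIdeal O) w 0) := hr 0
    have h1 : IsPullback (𝟙 Y₀) ιY (ιY ≫ e 0) (e 0) := h0sq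
    have h2 : IsPullback (𝟙 Y₀ ≫ r 0) ιY i (e 0 ≫ infinitesimalNeighbourhood.ι (IsLocalRing.maximalIdeal O) w 0) := h1.paste_horiz hr0
    rw [Category.id_comp, he_ι] at h2
    rw [← ker_fst_of_isClosedImmersion i jW, ← h2.flip.isoPullback_inv_fst, Scheme.Hom.ker_comp_of_isIso]

/-- **The registered NEED-FACT stub, modulo exactly two published facts**: `stub_elnat_embeddedCurveLiftFact : EmbeddedCurveLiftFact` holds given
J1 = `EmbeddedInfinitesimalLiftFact` (Hartshorne 2010 Thm. 6.2 (b) / 9.2 (b)) and F-88 = `FormalGeometry.GrothendieckExistence` (EGA III₁ 5.1.4 / GW II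
24.109): the assembly above composed with `embeddedCurveLiftFact_of_embeddedLiftFact` (…NatEmbeddedCurveLiftOfFactClosed, p597023).
[OURS · L1 W4.5b · (T-k) ‖ K·F on {J1, F-88}] toward `stub_elnat_embeddedCurveLiftFact`; NOT a statement of the manuscript. -/
theorem embeddedCurveLiftFact_of_infinitesimal_of_grothendieckExistence
    (hJ1 : EmbeddedInfinitesimalLiftFact) (hGE : GrothendieckExistence.{0}) : EmbeddedCurveLiftFact :=
  embeddedCurveLiftFact_of_embeddedLiftFact (embeddedLiftFact_of_infinitesimal_of_grothendieckExistence hJ1 hGE)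

end Summit.ResolutionOfSingularities.ResolutionOfSingularities.Cruxes.EquisingularLiftNat.Sections

end
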